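import Summits.Ventures.HSemireg.DerivedDescentTriangle
import Summits.Ventures.HSemireg.DerivedDescentCommShift
import HarnessLib

/-!
# `shiftedHomMap` is multiplicative and compatible with composition of functors
# (gs-g4 gen 22, brick C7a of `general-structure/COMPLEX-LEIBNIZ-PLAN-gs-g4.md`)

HONEST FRAMING. Generic Mathlib-level plumbing for p3's `DerivedDescent` (`derivedLift Φ`, `derivedLiftFac`,
`shiftedHomMap`): nothing about any variety; nothing here says HC, HC_CM or HC_AV is proved.

* `shiftedHomMap_comp'` — **`Φ_*(x · y) = Φ_*(x) · Φ_*(y)`** (Mathlib `ShiftedHom.comp` / `ShiftedHom.map_comp`; the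
  factorisation isomorphisms cancel in the middle).
* `liftingComp`, `derivedLiftCompIso : derivedLift (Φ₁ ⋙ Φ₂) ≅ derivedLift Φ₁ ⋙ derivedLift Φ₂` (uniqueness of
  localization lifts, Mathlib `Localization.liftNatIso`), its values on `Q K`, its shift-compatibility, and
  **`shiftedHomMap_functor_comp`**: `(Φ₁ ⋙ Φ₂)_*(y) = (Φ₂)_*((Φ₁)_*(y))`.
USE (sequel, hσ on complex carriers): `Φ₁ = - ⊗ M` termwise, `Φ₂ = 𝓗om•(E₀ ⊗ M, –)`, against the natural transformation
`𝓗om•(E₀, –) ⟶ 𝓗om•(E₀ ⊗ M, – ⊗ M)` and p3's `shiftedHomMap_comp_shift_map`.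

## References

* Mathlib: `CategoryTheory.Localization.Predicate` (`liftNatTrans`, `Lifting`), `CategoryTheory.Shift.ShiftedHom`. [folklore]
-/

noncomputable section

open CategoryTheory CategoryTheory.Category

namespace Summit.Ventures.HSemireg

universe w' v' u'

variable {C : Type u'} [Category.{v'} C] [Abelian C] [HasDerivedCategory.{w'} C]

/-! ### Multiplicativity -/

section Mul

variable (Φ : CochainComplex C ℤ ⥤ CochainComplex C ℤ) [Φ.CommShift ℤ]
  (hΦ : (HomologicalComplex.quasiIso C (ComplexShape.up ℤ)).IsInvertedBy (Φ ⋙ DerivedCategory.Q))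

/-- The factorisation `Q ⋙ derivedLift Φ ≅ Φ ⋙ Q` commutes with shifts, for ANY `Φ` (Mathlib
`NatTrans.commShift_iso_hom_of_localization`; `DerivedDescentTriangle` records the bifunctor case). [folklore] -/
instance commShift_derivedLiftFac_hom : NatTrans.CommShift (derivedLiftFac Φ hΦ).hom ℤ :=
  NatTrans.commShift_iso_hom_of_localization DerivedCategory.Q (HomologicalComplex.quasiIso C (ComplexShape.up ℤ)) ℤ
    (Φ ⋙ DerivedCategory.Q) (derivedLift Φ hΦ)

set_option backward.isDefEq.respectTransparency false in
/-- `Φ_*(y)` in sandwich form: `Fac.inv_K ≫ y.map (derivedLift Φ) ≫ Fac.hom_L⟦n⟧'` (the definition, restated).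
[folklore] -/
theorem shiftedHomMap_eq {K L : CochainComplex C ℤ} {n : ℤ}
    (y : ShiftedHom (DerivedCategory.Q.obj K) (DerivedCategory.Q.obj L) n) :
    shiftedHomMap Φ hΦ y =
      (derivedLiftFac Φ hΦ).inv.app K ≫ y.map (derivedLift Φ hΦ) ≫ ((derivedLiftFac Φ hΦ).hom.app L)⟦n⟧' :=
  rfl

set_option backward.isDefEq.respectTransparency false in
/-- **`Φ_*(x · y) = Φ_*(x) · Φ_*(y)`**: p3's `shiftedHomMap` is multiplicative for Mathlib's `ShiftedHom.comp`.
[folklore] -/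
theorem shiftedHomMap_comp' {K L M : CochainComplex C ℤ} {a b c : ℤ}
    (x : ShiftedHom (DerivedCategory.Q.obj K) (DerivedCategory.Q.obj L) a)
    (y : ShiftedHom (DerivedCategory.Q.obj L) (DerivedCategory.Q.obj M) b) (h : b + a = c) :
    shiftedHomMap Φ hΦ (x.comp y h) = (shiftedHomMap Φ hΦ x).comp (shiftedHomMap Φ hΦ y) h := by
  simp only [shiftedHomMap_eq]
  rw [ShiftedHom.map_comp]
  simp only [ShiftedHom.comp, Functor.map_comp, Category.assoc]
  rw [← (shiftFunctor (DerivedCategory C) a).map_comp_assoc ((derivedLiftFac Φ hΦ).hom.app L)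
    ((derivedLiftFac Φ hΦ).inv.app L), Iso.hom_inv_id_app]
  erw [CategoryTheory.Functor.map_id, Category.id_comp]
  erw [← (shiftFunctorAdd' (DerivedCategory C) b a c h).inv.naturality ((derivedLiftFac Φ hΦ).hom.app M)]
  rfl

end Mul

/-! ### Composition of functors -/

section Comp

variable (Φ₁ Φ₂ : CochainComplex C ℤ ⥤ CochainComplex C ℤ)
  (hΦ₁ : (HomologicalComplex.quasiIso C (ComplexShape.up ℤ)).IsInvertedBy (Φ₁ ⋙ DerivedCategory.Q))
  (hΦ₂ : (HomologicalComplex.quasiIso C (ComplexShape.up ℤ)).IsInvertedBy (Φ₂ ⋙ DerivedCategory.Q))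
  (hΦ₁₂ : (HomologicalComplex.quasiIso C (ComplexShape.up ℤ)).IsInvertedBy ((Φ₁ ⋙ Φ₂) ⋙ DerivedCategory.Q))

/-- The composite factorisation `Q ⋙ (L₁ ⋙ L₂) ≅ (Φ₁ ⋙ Φ₂) ⋙ Q` (whiskerings of the two factorisations). [folklore] -/
def liftingCompIso :
    DerivedCategory.Q ⋙ (derivedLift Φ₁ hΦ₁ ⋙ derivedLift Φ₂ hΦ₂) ≅ (Φ₁ ⋙ Φ₂) ⋙ DerivedCategory.Q :=
  (Functor.associator _ _ _).symm ≪≫ Functor.isoWhiskerRight (derivedLiftFac Φ₁ hΦ₁) _ ≪≫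
    Functor.associator _ _ _ ≪≫ Functor.isoWhiskerLeft Φ₁ (derivedLiftFac Φ₂ hΦ₂) ≪≫ (Functor.associator _ _ _).symm

/-- `derivedLift Φ₁ ⋙ derivedLift Φ₂` lifts `(Φ₁ ⋙ Φ₂) ⋙ Q` along `Q`. [folklore] -/
instance liftingComp : Localization.Lifting DerivedCategory.Q (HomologicalComplex.quasiIso C (ComplexShape.up ℤ))
    ((Φ₁ ⋙ Φ₂) ⋙ DerivedCategory.Q) (derivedLift Φ₁ hΦ₁ ⋙ derivedLift Φ₂ hΦ₂) :=
  ⟨liftingCompIso Φ₁ Φ₂ hΦ₁ hΦ₂⟩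

/-- The composite factorisation, unfolded. [folklore] -/
theorem liftingCompIso_hom : (liftingCompIso Φ₁ Φ₂ hΦ₁ hΦ₂).hom =
    (Functor.associator DerivedCategory.Q (derivedLift Φ₁ hΦ₁) (derivedLift Φ₂ hΦ₂)).inv ≫
      Functor.whiskerRight (derivedLiftFac Φ₁ hΦ₁).hom (derivedLift Φ₂ hΦ₂) ≫
        (Functor.associator Φ₁ DerivedCategory.Q (derivedLift Φ₂ hΦ₂)).hom ≫
          Functor.whiskerLeft Φ₁ (derivedLiftFac Φ₂ hΦ₂).hom ≫ (Functor.associator Φ₁ Φ₂ DerivedCategory.Q).inv :=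
  rfl

/-- The composite factorisation on an object. [folklore] -/
theorem liftingCompIso_hom_app (K : CochainComplex C ℤ) :
    (liftingCompIso Φ₁ Φ₂ hΦ₁ hΦ₂).hom.app K =
      (derivedLift Φ₂ hΦ₂).map ((derivedLiftFac Φ₁ hΦ₁).hom.app K) ≫ (derivedLiftFac Φ₂ hΦ₂).hom.app (Φ₁.obj K) := by
  rw [liftingCompIso_hom]
  simp only [NatTrans.comp_app, Functor.associator_inv_app, Functor.whiskerRight_app, Functor.associator_hom_app,
    Functor.whiskerLeft_app]
  erw [Category.id_comp, Category.id_comp, Category.comp_id]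
  rfl

/-- Its inverse on an object. [folklore] -/
theorem liftingCompIso_inv_app (K : CochainComplex C ℤ) :
    (liftingCompIso Φ₁ Φ₂ hΦ₁ hΦ₂).inv.app K =
      (derivedLiftFac Φ₂ hΦ₂).inv.app (Φ₁.obj K) ≫ (derivedLift Φ₂ hΦ₂).map ((derivedLiftFac Φ₁ hΦ₁).inv.app K) := by
  apply (cancel_epi ((liftingCompIso Φ₁ Φ₂ hΦ₁ hΦ₂).hom.app K)).1
  rw [Iso.hom_inv_id_app, liftingCompIso_hom_app]
  erw [Category.assoc, Iso.hom_inv_id_app_assoc, ← Functor.map_comp, Iso.hom_inv_id_app,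
    CategoryTheory.Functor.map_id]
  rfl

/-- **`derivedLift (Φ₁ ⋙ Φ₂) ≅ derivedLift Φ₁ ⋙ derivedLift Φ₂`** (uniqueness of localization lifts). [folklore] -/
def derivedLiftCompIso : derivedLift (Φ₁ ⋙ Φ₂) hΦ₁₂ ≅ derivedLift Φ₁ hΦ₁ ⋙ derivedLift Φ₂ hΦ₂ :=
  Localization.liftNatIso DerivedCategory.Q (HomologicalComplex.quasiIso C (ComplexShape.up ℤ))
    ((Φ₁ ⋙ Φ₂) ⋙ DerivedCategory.Q) ((Φ₁ ⋙ Φ₂) ⋙ DerivedCategory.Q) _ _ (Iso.refl _)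

/-- `Fac₁₂.inv_K ≫ e.hom_{Q K} = Fac₂.inv_{Φ₁ K} ≫ L₂(Fac₁.inv_K)`. [folklore] -/
theorem derivedLiftFac_inv_comp_derivedLiftCompIso_hom (K : CochainComplex C ℤ) :
    (derivedLiftFac (Φ₁ ⋙ Φ₂) hΦ₁₂).inv.app K ≫ (derivedLiftCompIso Φ₁ Φ₂ hΦ₁ hΦ₂ hΦ₁₂).hom.app (DerivedCategory.Q.obj K) =
      (derivedLiftFac Φ₂ hΦ₂).inv.app (Φ₁.obj K) ≫ (derivedLift Φ₂ hΦ₂).map ((derivedLiftFac Φ₁ hΦ₁).inv.app K) := by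
  rw [derivedLiftCompIso, Localization.liftNatIso_hom, Localization.liftNatTrans_app, Iso.refl_hom, NatTrans.id_app,
    Category.id_comp]
  change (derivedLiftFac (Φ₁ ⋙ Φ₂) hΦ₁₂).inv.app K ≫ (derivedLiftFac (Φ₁ ⋙ Φ₂) hΦ₁₂).hom.app K ≫
    (liftingCompIso Φ₁ Φ₂ hΦ₁ hΦ₂).inv.app K = _
  rw [Iso.inv_hom_id_app_assoc, liftingCompIso_inv_app]

/-- `e.inv_{Q L} ≫ Fac₁₂.hom_L = L₂(Fac₁.hom_L) ≫ Fac₂.hom_{Φ₁ L}`. [folklore] -/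
theorem derivedLiftCompIso_inv_comp_derivedLiftFac_hom (L : CochainComplex C ℤ) :
    (derivedLiftCompIso Φ₁ Φ₂ hΦ₁ hΦ₂ hΦ₁₂).inv.app (DerivedCategory.Q.obj L) ≫ (derivedLiftFac (Φ₁ ⋙ Φ₂) hΦ₁₂).hom.app L =
      (derivedLift Φ₂ hΦ₂).map ((derivedLiftFac Φ₁ hΦ₁).hom.app L) ≫ (derivedLiftFac Φ₂ hΦ₂).hom.app (Φ₁.obj L) := by
  rw [derivedLiftCompIso, Localization.liftNatIso_inv, Localization.liftNatTrans_app, Iso.refl_inv, NatTrans.id_app,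
    Category.id_comp]
  change ((liftingCompIso Φ₁ Φ₂ hΦ₁ hΦ₂).hom.app L ≫ (derivedLiftFac (Φ₁ ⋙ Φ₂) hΦ₁₂).inv.app L) ≫
    (derivedLiftFac (Φ₁ ⋙ Φ₂) hΦ₁₂).hom.app L = _
  rw [Category.assoc, Iso.inv_hom_id_app, liftingCompIso_hom_app]
  erw [Category.comp_id]

variable [Φ₁.CommShift ℤ] [Φ₂.CommShift ℤ]

/-- The whiskered factorisations commute with shifts. [folklore] -/
instance liftingCompIso_hom_commShift : NatTrans.CommShift (liftingCompIso Φ₁ Φ₂ hΦ₁ hΦ₂).hom ℤ := by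
  rw [liftingCompIso_hom]; infer_instance

/-- The comparison `derivedLift (Φ₁ ⋙ Φ₂) ≅ derivedLift Φ₁ ⋙ derivedLift Φ₂` commutes with shifts. [folklore] -/
instance derivedLiftCompIso_hom_commShift : NatTrans.CommShift (derivedLiftCompIso Φ₁ Φ₂ hΦ₁ hΦ₂ hΦ₁₂).hom ℤ := by
  haveI : NatTrans.CommShift (Localization.Lifting.iso DerivedCategory.Q
      (HomologicalComplex.quasiIso C (ComplexShape.up ℤ)) ((Φ₁ ⋙ Φ₂) ⋙ DerivedCategory.Q)
      (derivedLift Φ₁ hΦ₁ ⋙ derivedLift Φ₂ hΦ₂)).hom ℤ :=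
    inferInstanceAs (NatTrans.CommShift (liftingCompIso Φ₁ Φ₂ hΦ₁ hΦ₂).hom ℤ)
  haveI : NatTrans.CommShift (Localization.Lifting.iso DerivedCategory.Q
      (HomologicalComplex.quasiIso C (ComplexShape.up ℤ)) ((Φ₁ ⋙ Φ₂) ⋙ DerivedCategory.Q)
      (derivedLift (Φ₁ ⋙ Φ₂) hΦ₁₂)).hom ℤ :=
    inferInstanceAs (NatTrans.CommShift (derivedLiftFac (Φ₁ ⋙ Φ₂) hΦ₁₂).hom ℤ)
  haveI : NatTrans.CommShift (Iso.refl ((Φ₁ ⋙ Φ₂) ⋙ DerivedCategory.Q)).hom ℤ :=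
    inferInstanceAs (NatTrans.CommShift (𝟙 ((Φ₁ ⋙ Φ₂) ⋙ DerivedCategory.Q)) ℤ)
  exact natTrans_commShift_liftNatTrans DerivedCategory.Q (HomologicalComplex.quasiIso C (ComplexShape.up ℤ)) ℤ
    ((Φ₁ ⋙ Φ₂) ⋙ DerivedCategory.Q) ((Φ₁ ⋙ Φ₂) ⋙ DerivedCategory.Q)
    (derivedLift (Φ₁ ⋙ Φ₂) hΦ₁₂) (derivedLift Φ₁ hΦ₁ ⋙ derivedLift Φ₂ hΦ₂) (Iso.refl _).hom

set_option backward.isDefEq.respectTransparency false in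
/-- **`(Φ₁ ⋙ Φ₂)_* = (Φ₂)_* ∘ (Φ₁)_*` on shifted Homs** (the comparison isomorphism and the three factorisations
cancel; Mathlib `ShiftedHom.map_naturality_2`, `ShiftedHom.comp_map`). [folklore] -/
theorem shiftedHomMap_functor_comp {K L : CochainComplex C ℤ} {n : ℤ}
    (y : ShiftedHom (DerivedCategory.Q.obj K) (DerivedCategory.Q.obj L) n) :
    shiftedHomMap (Φ₁ ⋙ Φ₂) hΦ₁₂ y = shiftedHomMap Φ₂ hΦ₂ (shiftedHomMap Φ₁ hΦ₁ y) := by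
  -- both sides equal `(Fac₂.inv ≫ L₂ Fac₁.inv) ≫ y.map (L₁ ⋙ L₂) ≫ (L₂ Fac₁.hom ≫ Fac₂.hom)⟦n⟧'`
  have hL : shiftedHomMap (Φ₁ ⋙ Φ₂) hΦ₁₂ y =
      ((derivedLiftFac Φ₂ hΦ₂).inv.app (Φ₁.obj K) ≫ (derivedLift Φ₂ hΦ₂).map ((derivedLiftFac Φ₁ hΦ₁).inv.app K)) ≫
        y.map (derivedLift Φ₁ hΦ₁ ⋙ derivedLift Φ₂ hΦ₂) ≫
          ((derivedLift Φ₂ hΦ₂).map ((derivedLiftFac Φ₁ hΦ₁).hom.app L) ≫ (derivedLiftFac Φ₂ hΦ₂).hom.app (Φ₁.obj L))⟦n⟧' := by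
    have hnat := ShiftedHom.map_naturality_2 y (derivedLiftCompIso Φ₁ Φ₂ hΦ₁ hΦ₂ hΦ₁₂)
    rw [ShiftedHom.comp_mk₀, ShiftedHom.mk₀_comp] at hnat
    rw [shiftedHomMap_eq, ← hnat, Category.assoc, Category.assoc, ← Functor.map_comp,
      derivedLiftCompIso_inv_comp_derivedLiftFac_hom, ← Category.assoc, ← Category.assoc,
      derivedLiftFac_inv_comp_derivedLiftCompIso_hom, Category.assoc]
  have hR : shiftedHomMap Φ₂ hΦ₂ (shiftedHomMap Φ₁ hΦ₁ y) =
      ((derivedLiftFac Φ₂ hΦ₂).inv.app (Φ₁.obj K) ≫ (derivedLift Φ₂ hΦ₂).map ((derivedLiftFac Φ₁ hΦ₁).inv.app K)) ≫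
        y.map (derivedLift Φ₁ hΦ₁ ⋙ derivedLift Φ₂ hΦ₂) ≫
          ((derivedLift Φ₂ hΦ₂).map ((derivedLiftFac Φ₁ hΦ₁).hom.app L) ≫ (derivedLiftFac Φ₂ hΦ₂).hom.app (Φ₁.obj L))⟦n⟧' := by
    simp only [shiftedHomMap_eq, ShiftedHom.map, Functor.comp_map, Functor.commShiftIso_comp_hom_app, Functor.map_comp,
      Category.assoc]
    erw [Functor.commShiftIso_hom_naturality_assoc]
  rw [hL, hR]

end Comp

end Summit.Ventures.HSemireg

end
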